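import Summits.QuantumFields.YangMills.Theorems.BalabanUVNodesN08AlphaProfileGroupSU
import Summits.QuantumFields.YangMills.Theorems.BalabanUVNodesN08AlphaProfileConsts

/-!
# Route «BalabanUVNodes», Track-A DAG node N08 = [Balaban1985UV3] — (α) clause for `SU(N)`, `N ≥ 2`: N08 BY NAME at every record-world from the
# DATA SCHEMA ALONE (in-edge side EMPTY, no structural condition displayed)

Cell `pub-ymgap`, seat `pub-ymgap-dag-n08-d` gen 5, file F12 = F10 (`…ProfileGroupSU`: direction `suDir ∈ 𝔰𝔲(N) ∖ 0`) ∘ F11 (`…ProfileConsts`: the size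
condition met by `bump68`).  `bears_on: R4∕N08`; filed `--supports stmt-QuantumFields-19910 --as helper`.  Sorry-free, standard axioms.

★★ `b10_main_at_record_of_dataPin_su_bump` — for `G = SU(N)`, `N ≥ 2`: for any predicate `Rec` on binding worlds under which, at every run, SOME primitive
constants `𝔠₀`, standard-averaging base inputs `X₀`, a parameter `w`, bond sets `Bk`, expansion data `𝔖`, auxiliary data `𝔄` and sizes `coef` AT THE RECORD
`𝔠 := bump68 𝔠₀` — whose cluster-expansion DATA SCHEMA holds for the chosen inputs `XeOf …` on the family `g²ε₀ ≤ (min γ_N08^d 1)²` — bind the upstream as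
the C-binding over carriers whose B10 runs ARE the constructed family of `XeOf …`, N08 holds at every `Rec`-world and run.  The displayed clause is the
DATA schema and the pin; NOTHING of the in-edge side ((b7), (b11), [7] (3) = (42), h-large data, direction, size condition) remains.
★ `exists_externalInputs_b10_main_family_su_bump` — the family form at `bump68 𝔠₀`.
HONEST FRAMING: the DATA schema (`RunDataRows` = the cluster expansion of [B10]∕[8]–[10], census classes II + III) stays DISPLAYED — the object gap of
N08; count-neutral; NOT a discharge of N08.  d = 3 on finite tori as printed; nothing about d = 4, the continuum, OS axioms, a mass gap or Clay.
-/

noncomputable section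

namespace Summit.QuantumFields.YangMills.Theorems.BalabanUVNodesN08AlphaProfileSUEnd

open MeasureTheory Set
open scoped Matrix
open Literature.MathematicalPhysics.QuantumFieldTheory.Balaban1983to89
open Literature.MathematicalPhysics.QuantumFieldTheory.Balaban1983to89.B10SectCExpansion (TermSizes)
open Literature.MathematicalPhysics.QuantumFieldTheory.Balaban1985CMP102
open Literature.MathematicalPhysics.QuantumFieldTheory.Balaban1985CMP102.Setting
open Literature.MathematicalPhysics.QuantumFieldTheory.Balaban1983to89.DagBinding (leavesP WorldP PrintedCarriersR PrintedCarriers9X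
  PrintedCarriers11 PrintedCarriers14R PrintedCarriers15)
open Literature.MathematicalPhysics.QuantumFieldTheory.Balaban1983to89.B10CompactBinding (ofPrintedAllXPNC)
open Summit.QuantumFields.Balaban3D.Carriers
open Summit.QuantumFields.Balaban3D.Proofs.Inputs
open Summit.QuantumFields.Balaban3D.Proofs.Primitives (AlphaConsts)
open Summit.QuantumFields.Balaban3D.Proofs.GroupModelLieC (lieC)
open Summit.QuantumFields.Balaban3D.Proofs.UVStability3DInputs
open Summit.QuantumFields.Balaban3D.Proofs.FamilyLE (ScalesLE)
open Summit.QuantumFields.YangMills.Theorems.BalabanUVNodesN08AlphaClassI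
open Summit.QuantumFields.YangMills.Theorems.BalabanUVNodesN08AlphaLoop28
open Summit.QuantumFields.YangMills.Theorems.BalabanUVNodesN08AlphaThreeFaces (regMin)
open Summit.QuantumFields.YangMills.Theorems.BalabanUVNodesN08AlphaProfileThreshold
open Summit.QuantumFields.YangMills.Theorems.BalabanUVNodesN08AlphaProfileRecord
open Summit.QuantumFields.YangMills.Theorems.BalabanUVNodesN08AlphaProfileGroupSU
open Summit.QuantumFields.YangMills.Theorems.BalabanUVNodesN08AlphaProfileConsts

variable {L N : ℕ} [NeZero N]

/-- **★ THE FAMILY FORM FOR `SU(N)`, `N ≥ 2`, AT THE BUMPED RECORD — NO STRUCTURAL HYPOTHESIS** (F10's `exists_externalInputs_b10_main_family_su` at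
`𝔠 := bump68 𝔠₀`, size condition by `four_pi_le_regMin_bump68`).
[cite: Balaban1985UV3, Thm 1 p.257 (compact reading) + Thm 2 p.272 + (41)–(42) p.266 + (67)–(68) p.273; Balaban1985Variational, Thm 1 p.279; Balaban1985Averaging, Prop. 2 (54) p.26] -/
theorem exists_externalInputs_b10_main_family_su_bump (hN : 2 ≤ N) (𝔠₀ : AlphaConsts L (suGroupModel N).N)
    (X₀ : ∀ S : Scales L, ExternalInputs S (Matrix.specialUnitaryGroup (Fin N) ℂ))
    (hstd : ∀ S : Scales L, (X₀ S).av = AveragingRT.stdAvg S.P (Matrix.specialUnitaryGroup (Fin N) ℂ)) (w : ℝ)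
    (Bk : ∀ (S : Scales L) (k : ℕ), Hist S.P k → Set (PBond S.P k)) :
    ∃ Xe : ∀ S : Scales L, ExternalInputs S (Matrix.specialUnitaryGroup (Fin N) ℂ),
      (∀ S, (Xe S).av = AveragingRT.stdAvg S.P (Matrix.specialUnitaryGroup (Fin N) ℂ) ∧ (Xe S).reg = (X₀ S).reg) ∧
      (∀ S : Scales L, S.g ^ 2 * S.ε₀ ≤ (min (gammaN08d (bump68 𝔠₀)) 1) ^ 2 →
        (∀ (k : ℕ) (h : Hist S.P k), Measurable ((Xe S).UkH k h)) ∧ InEdgeFaces₃ (suGroupModel N) (regMin (bump68 𝔠₀)) (Xe S) ∧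
        ∀ (𝔖 : ∀ k, StepSeries S (Matrix.specialUnitaryGroup (Fin N) ℂ) ↥(lieC (suGroupModel N)) (nblkOf S (bump68 𝔠₀).lane.carrier k) k)
          (𝔄 : AlphaData (suGroupModel N) (bump68 𝔠₀) (Xe S) 𝔖)
          (coef : (k : ℕ) → Hist S.P (k + 1) → GaugeField S.P (k + 1) (Matrix.specialUnitaryGroup (Fin N) ℂ) → (j : ℕ) →
            TermSizes (oldGeom S.P k j)),
          RunDataRows (suGroupModel N) (bump68 𝔠₀) (Xe S) 𝔖 𝔄 (sizesOf (suGroupModel N) (bump68 𝔠₀) (Xe S) coef) →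
            RunAlpha (suGroupModel N) (bump68 𝔠₀) (Xe S) 𝔖 𝔄) ∧
      ∀ (𝔖 : ∀ (S : Scales L) (k : ℕ), StepSeries S (Matrix.specialUnitaryGroup (Fin N) ℂ) ↥(lieC (suGroupModel N))
          (nblkOf S (bump68 𝔠₀).lane.carrier k) k)
        (𝔄 : ∀ S : Scales L, AlphaData (suGroupModel N) (bump68 𝔠₀) (Xe S) (𝔖 S))
        (coef : ∀ (S : Scales L) (k : ℕ), Hist S.P (k + 1) → GaugeField S.P (k + 1) (Matrix.specialUnitaryGroup (Fin N) ℂ) → (j : ℕ) →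
          TermSizes (oldGeom S.P k j))
        (Xc : PrintedCarriersR) (Y : PrintedCarriers9X) (Z : PrintedCarriers11) (V : PrintedCarriers14R) (W : PrintedCarriers15)
        (w' : WorldP) (P : B12.RunParams),
        (∀ S : Scales L, S.g ^ 2 * S.ε₀ ≤ (min (gammaN08d (bump68 𝔠₀)) 1) ^ 2 →
          RunDataRows (suGroupModel N) (bump68 𝔠₀) (Xe S) (𝔖 S) (𝔄 S) (sizesOf (suGroupModel N) (bump68 𝔠₀) (Xe S) (coef S))) →
        w'.up P = ofPrintedAllXPNC (Xc.withTowerRuns10 fun S : ScalesLE L ((min (gammaN08d (bump68 𝔠₀)) 1) ^ 2) =>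
          towerOf (bump68 𝔠₀).lane (Xe S.1) (𝔖 S.1)) Y Z V W →
        Dag.B10_main (leavesP w' P) :=
  exists_externalInputs_b10_main_family_su hN (bump68 𝔠₀) X₀ hstd w (four_pi_le_regMin_bump68 𝔠₀) Bk

/-- **★★ RECORD-PREDICATE CLOSER FOR `SU(N)`, `N ≥ 2`, AT BUMPED RECORDS: THE DISPLAYED CLAUSE IS «DATA SCHEMA on `XeOf`» AND THE PIN — NOTHING OF THE
IN-EDGE SIDE** (F10's `b10_main_at_record_of_dataPin_su` with the size condition supplied by F11's `four_pi_le_regMin_bump68`).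
[cite: Balaban1985UV3, Thm 1 p.257 (compact reading) + Thm 2 p.272 (bookkeeping shape)] -/
theorem b10_main_at_record_of_dataPin_su_bump (hN : 2 ≤ N) (Rec : WorldP → Prop)
    (hpin : ∀ w', Rec w' → ∀ P : B12.RunParams,
      ∃ (𝔠₀ : AlphaConsts L (suGroupModel N).N)
        (X₀ : ∀ S : Scales L, ExternalInputs S (Matrix.specialUnitaryGroup (Fin N) ℂ))
        (hstd : ∀ S : Scales L, (X₀ S).av = AveragingRT.stdAvg S.P (Matrix.specialUnitaryGroup (Fin N) ℂ)) (w : ℝ)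
        (Bk : ∀ (S : Scales L) (k : ℕ), Hist S.P k → Set (PBond S.P k))
        (𝔖 : ∀ (S : Scales L) (k : ℕ), StepSeries S (Matrix.specialUnitaryGroup (Fin N) ℂ) ↥(lieC (suGroupModel N))
          (nblkOf S (bump68 𝔠₀).lane.carrier k) k)
        (𝔄 : ∀ S : Scales L, AlphaData (suGroupModel N) (bump68 𝔠₀)
          (XeOf (suGroupModel N) (bump68 𝔠₀) X₀ hstd w (suDir_mem_su hN) (suDir_ne_zero hN) (four_pi_le_regMin_bump68 𝔠₀) Bk S) (𝔖 S))
        (coef : ∀ (S : Scales L) (k : ℕ), Hist S.P (k + 1) → GaugeField S.P (k + 1) (Matrix.specialUnitaryGroup (Fin N) ℂ) → (j : ℕ) →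
          TermSizes (oldGeom S.P k j))
        (Xc : PrintedCarriersR) (Y : PrintedCarriers9X) (Z : PrintedCarriers11) (V : PrintedCarriers14R) (W : PrintedCarriers15),
        (∀ S : Scales L, S.g ^ 2 * S.ε₀ ≤ (min (gammaN08d (bump68 𝔠₀)) 1) ^ 2 →
            RunDataRows (suGroupModel N) (bump68 𝔠₀)
              (XeOf (suGroupModel N) (bump68 𝔠₀) X₀ hstd w (suDir_mem_su hN) (suDir_ne_zero hN) (four_pi_le_regMin_bump68 𝔠₀) Bk S) (𝔖 S) (𝔄 S)
              (sizesOf (suGroupModel N) (bump68 𝔠₀)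
                (XeOf (suGroupModel N) (bump68 𝔠₀) X₀ hstd w (suDir_mem_su hN) (suDir_ne_zero hN) (four_pi_le_regMin_bump68 𝔠₀) Bk S) (coef S))) ∧
          w'.up P = ofPrintedAllXPNC (Xc.withTowerRuns10 fun S : ScalesLE L ((min (gammaN08d (bump68 𝔠₀)) 1) ^ 2) =>
            towerOf (bump68 𝔠₀).lane
              (XeOf (suGroupModel N) (bump68 𝔠₀) X₀ hstd w (suDir_mem_su hN) (suDir_ne_zero hN) (four_pi_le_regMin_bump68 𝔠₀) Bk S.1)
              (𝔖 S.1)) Y Z V W) :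
    ∀ w', Rec w' → ∀ P, Dag.B10_main (leavesP w' P) := by
  refine b10_main_at_record_of_dataPin_su (L := L) hN Rec fun w' hw' P => ?_
  obtain ⟨𝔠₀, X₀, hstd, w, Bk, 𝔖, 𝔄, coef, Xc, Y, Z, V, W, hD, hup⟩ := hpin w' hw' P
  exact ⟨bump68 𝔠₀, four_pi_le_regMin_bump68 𝔠₀, X₀, hstd, w, Bk, 𝔖, 𝔄, coef, Xc, Y, Z, V, W, hD, hup⟩

end Summit.QuantumFields.YangMills.Theorems.BalabanUVNodesN08AlphaProfileSUEnd

end
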